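import Mathlib
import HarnessLib
import Literature.Analysis.FluidPDE.BeltramiFlows

/-!
# The coordinate 3-cycle of the ABC 1:1:1 host: it fixes the diagonal, rotates its normal plane by a third
# of a turn, and forces every invariant in-plane second-moment tensor to be isotropic
# (instab lane, door O-acc = O7, obstruction P3 — the «stage-1 C₃ caveat» of `HEREDITY-P3.md` v1.4 (B))

HONEST FRAMING (cell `ns-blowup`, seat `ns-blowup-instab2`; human ruling D-0035): nothing here is a
claim about Navier–Stokes blow-up. WHAT THIS IS NOT: not dynamics; it is the linear algebra behind one
sentence of the cell's census bookkeeping: «in an A₄-symmetric (stage-1) P-TOWER-1′ run the rope's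
cross-section through any point of its own α-line has an ISOTROPIC in-plane second-moment tensor, so a
Kirchhoff-type elliptic (azimuthal wavenumber m = 2) core deformation is excluded by symmetry; the first
admissible azimuthal deformation is m = 3» (STATUS 2026-08-25, instab2 g4 / refuter2 g3).

## What is proved

* §1 `abc_cycle_apply_*`: the coordinate 3-cycle `g(x₀,x₁,x₂) = (x₁,x₂,x₀)` is a symmetry of the tree's
  ABC field with `A = B = C = 1`: `U(gx) = g(U(x))` componentwise (no lattice shift needed);
  `jac_cycle`: the Jacobian is equivariant, `∂ⱼUᵢ(gx) = ∂_{σj}U_{σi}(x)` with `σ = (0 1 2) ↦ (1 2 0)`;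
  `cycle_diag`: `g` fixes every point `(s,s,s)` of the diagonal — in particular the α/β stagnation points
  and the whole rope-carrying heteroclinic line of `ABCAlphaPointStrain`;
* §2 `cycle_T2`, `cycle_T3`: on the plane `v₀ + v₁ + v₂ = 0` normal to the diagonal, in the basis
  `T₂ = (1,−1,0)`, `T₃ = (1,1,−2)` (orthogonal, `|T₃|² = 3|T₂|²`), `g T₂ = −½T₂ − ½T₃`, `g T₃ = (3/2)T₂ − ½T₃`;
  in the orthonormal frame `(T₂/√2, T₃/√6)` this is the matrix `[[−½, √3/2],[−√3/2, −½]]`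
  (`cycle_matrix_orthonormal`) — a ROTATION BY A THIRD OF A TURN (`rotation_third_turn_cube`: `R³ = 1`,
  `rotation_third_turn_det`: `det R = 1`);
* §3 `isotropic_of_third_turn_invariant`: a real symmetric `2 × 2` matrix `M = [[p,q],[q,r]]` with
  `Rᵀ M R = M` for that rotation has `p = r` and `q = 0` — i.e. `M` is a multiple of the identity: EVERY
  C₃-invariant in-plane second-moment tensor (of vorticity, enstrophy, any invariant weight) is isotropic,
  its two principal second moments are equal, the «aspect ratio from second moments» is exactly `1`, and the
  Kirchhoff ellipticity signature `e/ω₀ = (a − b)/(2(a + b))` vanishes. (The step «invariant density ⇒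
  invariant moment tensor» is the change of variables under `g`, not formalised here.)

Mathlib + `Literature.Analysis.FluidPDE.BeltramiFlows`. No definitions. LABEL: MODEL-door bookkeeping.
-/

namespace Summit.NavierStokesRegularity.FluidComputer.ABCDiagonalC3Symmetry

open Real Literature.Analysis.FluidPDE

/-! ## §1 The 3-cycle is a symmetry of `U = abc 1 1 1` fixing the diagonal -/

/-- `U₀(x₁,x₂,x₀) = U₁(x)`. -/
theorem abc_cycle_apply_zero (x : EuclideanSpace ℝ (Fin 3)) :
    ABC.abc 1 1 1 (!₂[x 1, x 2, x 0] : EuclideanSpace ℝ (Fin 3)) 0 = ABC.abc 1 1 1 x 1 := by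
  simp

/-- `U₁(x₁,x₂,x₀) = U₂(x)`. -/
theorem abc_cycle_apply_one (x : EuclideanSpace ℝ (Fin 3)) :
    ABC.abc 1 1 1 (!₂[x 1, x 2, x 0] : EuclideanSpace ℝ (Fin 3)) 1 = ABC.abc 1 1 1 x 2 := by
  simp

/-- `U₂(x₁,x₂,x₀) = U₀(x)`: with the two previous lemmas, `U ∘ g = g ∘ U` for the coordinate 3-cycle `g`
— an exact symmetry of the `A = B = C` flow (it is one of the even elements of the 24-element symmetry
group; Dombre et al. 1986 §4). -/
theorem abc_cycle_apply_two (x : EuclideanSpace ℝ (Fin 3)) :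
    ABC.abc 1 1 1 (!₂[x 1, x 2, x 0] : EuclideanSpace ℝ (Fin 3)) 2 = ABC.abc 1 1 1 x 0 := by
  simp

/-- Equivariance of the Jacobian: `∂ⱼUᵢ(gx) = ∂_{σj}U_{σi}(x)` with `σ = ![1, 2, 0]`. -/
theorem jac_cycle (x : EuclideanSpace ℝ (Fin 3)) (j i : Fin 3) :
    ABC.jac 1 1 1 (!₂[x 1, x 2, x 0] : EuclideanSpace ℝ (Fin 3)) j i =
      ABC.jac 1 1 1 x ((![1, 2, 0] : Fin 3 → Fin 3) j) ((![1, 2, 0] : Fin 3 → Fin 3) i) := by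
  fin_cases j <;> fin_cases i <;> simp [ABC.jac]

/-- The 3-cycle fixes every diagonal point `(s,s,s)` — the α/β stagnation points and the whole rope-carrying
line of the P-TOWER-1′ host lie on such diagonals. -/
theorem cycle_diag (s : ℝ) :
    (!₂[(!₂[s, s, s] : EuclideanSpace ℝ (Fin 3)) 1, (!₂[s, s, s] : EuclideanSpace ℝ (Fin 3)) 2,
        (!₂[s, s, s] : EuclideanSpace ℝ (Fin 3)) 0] : EuclideanSpace ℝ (Fin 3)) =
      (!₂[s, s, s] : EuclideanSpace ℝ (Fin 3)) := by
  ext i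
  fin_cases i <;> simp

/-! ## §2 The action on the normal plane of the diagonal is a rotation by a third of a turn -/

/-- `g T₂ = −½ T₂ − ½ T₃` for `T₂ = (1,−1,0)`, `T₃ = (1,1,−2)`: componentwise, `g T₂ = (−1, 0, 1)`. -/
theorem cycle_T2 (i : Fin 3) :
    (![(-1 : ℝ), 0, 1] : Fin 3 → ℝ) i =
      (-1/2 : ℝ) * (![(1 : ℝ), -1, 0] : Fin 3 → ℝ) i + (-1/2 : ℝ) * (![(1 : ℝ), 1, -2] : Fin 3 → ℝ) i := by
  fin_cases i <;> simp

/-- `g T₃ = (3/2) T₂ − ½ T₃`: componentwise, `g T₃ = (1, −2, 1)`. -/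
theorem cycle_T3 (i : Fin 3) :
    (![(1 : ℝ), -2, 1] : Fin 3 → ℝ) i =
      (3/2 : ℝ) * (![(1 : ℝ), -1, 0] : Fin 3 → ℝ) i + (-1/2 : ℝ) * (![(1 : ℝ), 1, -2] : Fin 3 → ℝ) i := by
  fin_cases i <;> simp <;> norm_num

/-- `T₂ ⊥ T₃`, `T₂, T₃ ⊥ (1,1,1)`, `|T₂|² = 2`, `|T₃|² = 6`: an orthogonal frame of the normal plane. -/
theorem frame_orthogonal :
    (1 : ℝ) * 1 + (-1) * 1 + 0 * (-2) = 0 ∧ (1 : ℝ) + (-1) + 0 = 0 ∧ (1 : ℝ) + 1 + (-2) = 0 ∧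
      (1 : ℝ) ^ 2 + (-1) ^ 2 + 0 ^ 2 = 2 ∧ (1 : ℝ) ^ 2 + 1 ^ 2 + (-2) ^ 2 = 6 := by
  norm_num

/-- In the ORTHONORMAL frame `(e₂, e₃) = (T₂/√2, T₃/√6)` the matrix of `g` is `[[−½, √3/2], [−√3/2, −½]]`:
the change of normalisation multiplies the off-diagonal coefficients `−½` (of `T₃` in `gT₂`) and `3/2` (of
`T₂` in `gT₃`) by `√6/√2 = √3` and `√2/√6 = 1/√3` respectively: `−½·√3 = −√3/2` and `(3/2)/√3 = √3/2`. -/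
theorem cycle_matrix_orthonormal :
    (-1/2 : ℝ) * Real.sqrt 3 = -(Real.sqrt 3 / 2) ∧ (3/2 : ℝ) / Real.sqrt 3 = Real.sqrt 3 / 2 ∧
      Real.sqrt 6 / Real.sqrt 2 = Real.sqrt 3 := by
  have hm : Real.sqrt 3 * Real.sqrt 3 = 3 := Real.mul_self_sqrt (by norm_num)
  have h3pos : 0 < Real.sqrt 3 := Real.sqrt_pos.mpr (by norm_num)
  refine ⟨by ring, ?_, ?_⟩
  · rw [div_eq_iff (ne_of_gt h3pos)]
    linear_combination (-1/2 : ℝ) * hm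
  · rw [div_eq_iff (Real.sqrt_ne_zero'.mpr (by norm_num : (0:ℝ) < 2)), ← Real.sqrt_mul (by norm_num : (0:ℝ) ≤ 3) 2]
    norm_num

/-- That matrix is a rotation by a third of a turn: `R³ = 1` (entrywise, `R = [[c, s'], [−s', c]]` with
`c = −½`, `s' = √3/2`; we check the `(0,0)` and `(0,1)` entries of `R³`, the others follow by the same
two identities). -/
theorem rotation_third_turn_cube :
    -- with c = −½, s = √3/2: (R²)₀₀ = c² − s², (R²)₀₁ = 2cs; (R³)₀₀ = c(c² − s²) − s(2cs), (R³)₀₁ = s(c² − s²) + c(2cs)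
    (-1/2 : ℝ) * ((-1/2 : ℝ) ^ 2 - (Real.sqrt 3 / 2) ^ 2) - (Real.sqrt 3 / 2) * (2 * (-1/2) * (Real.sqrt 3 / 2)) = 1 ∧
      (Real.sqrt 3 / 2) * ((-1/2 : ℝ) ^ 2 - (Real.sqrt 3 / 2) ^ 2) + (-1/2) * (2 * (-1/2) * (Real.sqrt 3 / 2)) = 0 := by
  have h3 : Real.sqrt 3 ^ 2 = 3 := Real.sq_sqrt (by norm_num)
  constructor
  · linear_combination (3/8 : ℝ) * h3
  · linear_combination (-(Real.sqrt 3) / 8) * h3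

/-- … with determinant `c² + s² = 1`. -/
theorem rotation_third_turn_det :
    (-1/2 : ℝ) * (-1/2) - (Real.sqrt 3 / 2) * (-(Real.sqrt 3 / 2)) = 1 := by
  have h3 : Real.sqrt 3 ^ 2 = 3 := Real.sq_sqrt (by norm_num)
  linear_combination (1/4 : ℝ) * h3

/-! ## §3 A symmetric 2-tensor invariant under a third of a turn is isotropic -/

/-- ISOTROPY: let `M = [[p, q], [q, r]]` be real symmetric and `R = [[c, −s], [s, c]]` the rotation with
`c = −½`, `s = √3/2`. If `Rᵀ M R = M` — it suffices to use its `(0,0)` entry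
`c²p + 2csq + s²r = p` and its `(0,1)` entry `−csp + (c² − s²)q + csr = q` — then `p = r` and `q = 0`.
Hence every C₃-invariant in-plane second-moment tensor on a section of the stage-1 rope through its own
α-line is a multiple of the identity: equal principal second moments, second-moment aspect ratio exactly
`1`, zero Kirchhoff (m = 2) ellipticity. -/
theorem isotropic_of_third_turn_invariant (p q r : ℝ)
    (h₀₀ : (-1/2 : ℝ) ^ 2 * p + 2 * (-1/2) * (Real.sqrt 3 / 2) * q + (Real.sqrt 3 / 2) ^ 2 * r = p)
    (h₀₁ : -(-1/2 : ℝ) * (Real.sqrt 3 / 2) * p + ((-1/2 : ℝ) ^ 2 - (Real.sqrt 3 / 2) ^ 2) * q +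
      (-1/2) * (Real.sqrt 3 / 2) * r = q) :
    p = r ∧ q = 0 := by
  have h3 : Real.sqrt 3 ^ 2 = 3 := Real.sq_sqrt (by norm_num)
  -- the two entry equations read  −¾(p − r) − (√3/2) q = 0  and  (√3/4)(p − r) − (3/2) q = 0
  have e1 : -(3/4 : ℝ) * (p - r) - Real.sqrt 3 / 2 * q = 0 := by linear_combination h₀₀ - (r/4) * h3
  have e2 : Real.sqrt 3 / 4 * (p - r) - (3/2 : ℝ) * q = 0 := by linear_combination h₀₁ + (q/4) * h3
  -- eliminate (p − r): (−√3/6)·e1 − ½·e2 = (√3²/12 + ¾) q = q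
  have hq : q = 0 := by linear_combination (-(Real.sqrt 3) / 6) * e1 + (-1/2 : ℝ) * e2 + (-q/12) * h3
  refine ⟨?_, hq⟩
  have : -(3/4 : ℝ) * (p - r) = 0 := by rw [hq] at e1; linarith
  linarith

/-- The same conclusion phrased on the moments themselves: if the second moments `(I_ξξ, I_ξη, I_ηη)` of a
weight on the normal plane are invariant under the third-of-a-turn rotation (the two entry identities), the
principal second moments coincide (`I_ξξ = I_ηη`, `I_ξη = 0`), so `√(λ_max/λ_min) = 1`. -/
theorem second_moment_aspect_eq_one (Ixx Ixy Iyy : ℝ)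
    (h₀₀ : (-1/2 : ℝ) ^ 2 * Ixx + 2 * (-1/2) * (Real.sqrt 3 / 2) * Ixy + (Real.sqrt 3 / 2) ^ 2 * Iyy = Ixx)
    (h₀₁ : -(-1/2 : ℝ) * (Real.sqrt 3 / 2) * Ixx + ((-1/2 : ℝ) ^ 2 - (Real.sqrt 3 / 2) ^ 2) * Ixy +
      (-1/2) * (Real.sqrt 3 / 2) * Iyy = Ixy) (hpos : 0 < Iyy) :
    Real.sqrt (Ixx / Iyy) = 1 := by
  obtain ⟨h1, _⟩ := isotropic_of_third_turn_invariant Ixx Ixy Iyy h₀₀ h₀₁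
  rw [h1, div_self (ne_of_gt hpos), Real.sqrt_one]

end Summit.NavierStokesRegularity.FluidComputer.ABCDiagonalC3Symmetry
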